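import Mathlib

/-!
  Sketch_sidea_k2_g26.lean — stub-ideation k2 g26 (technique: LITERATURE TRANSFER, typed dictionary)
  for crux `ResidualThetaCountLowerPureAtTwo` (stmt-BirchSwinnertonDyer-26074), stub `stub_cmLambdaLower`
  (= item RSL_g, stmt-BirchSwinnertonDyer-22608, text verbatim — never re-typed here).

  HONESTY: BSD is NOT proved by any of this; 22608 / 26074 / 24105 stay OPEN / HOLD. This file is
  Mathlib-only MODEL ALGEBRA (0 sorry, 0 axiom, 0 def / instance / notation): the formal content of
  dictionary row D1 of the card `Ideas/stub_cmLambdaLower-k2.md` (g26) —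
  «Burungale–Tian 2026 / Kato 2004 state Thm 2.6 / Thm 12.4–12.5 over the FULL tower
   `G_∞ = Gal(ℚ(ζ_{2^∞})/ℚ) ≃ ℤ₂^× ≃ ℤ₂ × Δ`, `Δ ≃ ℤ/2` at `p = 2` [BT26 p. 4]; the tree's carrier
   `Kato2004.IwasawaH1DataCoeff ρ 2 κ γ` is the Γ-LINE (cyclotomic ℤ₂-extension `ℚ_∞ = ℚ(ζ_{2^∞})⁺`).
   The passage is `res`/`cor` for the degree-2 extension `ℚ(ζ_{2^{n+2}}) / ℚ_n` with `cor ∘ res = 2`,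
   `res ∘ cor = 1 + c` (`c` = complex conjugation): after inverting `2` (coefficients `F_λ = 𝒪_λ ⊗ ℚ`,
   which is all BT26 Thm 2.6 offers) `res` is an ISOMORPHISM onto the `c`-invariants (the `+`-component),
   so every `⊗ℚ` statement descends from the `G_∞`-tower to the Γ-line componentwise — as recorded in
   prose in `Literature/…/Kato2004/IwasawaCohomologyCoeffNewform.lean` READING (R2) (β₂.1)–(β₂.4) and
   `Kato2004/ZetaQuotientPackageCoeff.lean` READING («2 ∈ (Λ ⊗ ℚ)ˣ»).»
  The lemmas below are that descent in kernel, for an arbitrary commutative ring `R` with `IsUnit (2 : R)`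
  and abstract maps `res`, `cor`, `σ`; they have NO tree consumer today (the interface
  `IwasawaH1DataCoeff` axiomatises `proj` / `cores` directly) and are filed as the checkable form of D1.
-/

set_option linter.dupNamespace false

namespace Summit.BirchSwinnertonDyer.BirchSwinnertonDyer.Cruxes.ResidualThetaCountLowerPureAtTwo.SideaK2G26

variable {R : Type*} [CommRing R]
variable {M N : Type*} [AddCommGroup M] [Module R M] [AddCommGroup N] [Module R N]

/-- D1-a. `cor ∘ res = 2` with `2 ∈ Rˣ` forces `res` injective (no `2`-torsion is lost after `⊗ ℚ`). -/
theorem res_injective_of_cor_comp_res (res : M →ₗ[R] N) (cor : N →ₗ[R] M)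
    (hcr : cor ∘ₗ res = (2 : R) • LinearMap.id) (h2 : IsUnit (2 : R)) :
    Function.Injective res := by
  obtain ⟨u, hu⟩ := h2
  intro x y hxy
  have hx : cor (res x) = (2 : R) • x := by
    simpa using LinearMap.congr_fun hcr x
  have hy : cor (res y) = (2 : R) • y := by
    simpa using LinearMap.congr_fun hcr y
  have h : (2 : R) • x = (2 : R) • y := by rw [← hx, ← hy, hxy]
  have h' : ((↑u⁻¹ : R) * 2) • x = ((↑u⁻¹ : R) * 2) • y := by
    rw [mul_smul, mul_smul, h]
  simpa [← hu] using h'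

/-- D1-b. `res ∘ cor = 1 + σ` and `σ ∘ res = res` (restriction lands in the `σ`-invariants) with
`2 ∈ Rˣ`: the image of `res` is EXACTLY the `σ`-invariants `ker (σ − 1)` (the `+`-component). -/
theorem range_res_eq_ker_sub (res : M →ₗ[R] N) (cor : N →ₗ[R] M) (σ : N →ₗ[R] N)
    (hrc : res ∘ₗ cor = LinearMap.id + σ) (hσ : σ ∘ₗ res = res) (h2 : IsUnit (2 : R)) :
    LinearMap.range res = LinearMap.ker (σ - LinearMap.id) := by
  obtain ⟨u, hu⟩ := h2
  ext y
  constructor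
  · rintro ⟨x, rfl⟩
    have hx : σ (res x) = res x := LinearMap.congr_fun hσ x
    simp [LinearMap.mem_ker, hx]
  · intro hy
    have hy' : σ y = y := by
      have : σ y - y = 0 := by simpa [LinearMap.mem_ker] using hy
      exact sub_eq_zero.mp this
    refine ⟨(↑u⁻¹ : R) • cor y, ?_⟩
    have h1 : res (cor y) = y + σ y := by
      simpa using LinearMap.congr_fun hrc y
    rw [map_smul, h1, hy', ← two_smul R y, smul_smul, ← hu, Units.inv_mul, one_smul]

/-- D1-c. Packaging: under the three identities, `res` is a LINEAR EQUIVALENCE of the downstairs module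
onto the `σ`-invariants upstairs (the componentwise descent `G_∞`-tower ⟶ Γ-line after `⊗ ℚ`). -/
theorem exists_linearEquiv_invariants (res : M →ₗ[R] N) (cor : N →ₗ[R] M) (σ : N →ₗ[R] N)
    (hcr : cor ∘ₗ res = (2 : R) • LinearMap.id) (hrc : res ∘ₗ cor = LinearMap.id + σ)
    (hσ : σ ∘ₗ res = res) (h2 : IsUnit (2 : R)) :
    ∃ e : M ≃ₗ[R] LinearMap.ker (σ - LinearMap.id), ∀ x, (e x : N) = res x := by
  have hinj := res_injective_of_cor_comp_res res cor hcr h2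
  have hrange := range_res_eq_ker_sub res cor σ hrc hσ h2
  have hmem : ∀ x, res x ∈ LinearMap.ker (σ - LinearMap.id) := by
    intro x
    rw [← hrange]
    exact LinearMap.mem_range_self res x
  let f : M →ₗ[R] LinearMap.ker (σ - LinearMap.id) := LinearMap.codRestrict _ res hmem
  have hf_inj : Function.Injective f := by
    intro x y hxy
    apply hinj
    simpa [f] using congrArg (fun z : LinearMap.ker (σ - LinearMap.id) => (z : N)) hxy
  have hf_surj : Function.Surjective f := by
    rintro ⟨y, hy⟩
    have : y ∈ LinearMap.range res := by rw [hrange]; exact hy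
    obtain ⟨x, rfl⟩ := this
    exact ⟨x, rfl⟩
  exact ⟨LinearEquiv.ofBijective f ⟨hf_inj, hf_surj⟩, fun x => rfl⟩

/-- D1-d. Consequence for the λ-currency (ranks / `finrank` over the coefficient FIELD after `⊗ ℚ`):
downstairs rank = rank of the `+`-component upstairs; so a rank-one / torsion / characteristic-ideal
statement printed componentwise on the `G_∞`-tower IS the Γ-line statement, and conversely. -/
theorem finrank_eq_finrank_invariants (res : M →ₗ[R] N) (cor : N →ₗ[R] M) (σ : N →ₗ[R] N)
    (hcr : cor ∘ₗ res = (2 : R) • LinearMap.id) (hrc : res ∘ₗ cor = LinearMap.id + σ)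
    (hσ : σ ∘ₗ res = res) (h2 : IsUnit (2 : R)) :
    Module.finrank R M = Module.finrank R (LinearMap.ker (σ - LinearMap.id)) := by
  obtain ⟨e, -⟩ := exists_linearEquiv_invariants res cor σ hcr hrc hσ h2
  exact e.finrank_eq

/-- D1-e. The `−`-component is the same lemma for the sign-twisted action: if instead
`σ ∘ res' = −res'` (restriction of the ε-twisted module lands in the anti-invariants) and
`res' ∘ cor' = 1 − σ`, then `res'` is an equivalence onto `ker (σ + 1)`.  Stated as the range
identity; proof = D1-b applied to `−σ`. -/
theorem range_res_eq_ker_add (res : M →ₗ[R] N) (cor : N →ₗ[R] M) (σ : N →ₗ[R] N)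
    (hrc : res ∘ₗ cor = LinearMap.id - σ) (hσ : σ ∘ₗ res = -res) (h2 : IsUnit (2 : R)) :
    LinearMap.range res = LinearMap.ker (σ + LinearMap.id) := by
  have h := range_res_eq_ker_sub res cor (-σ) (by rw [hrc, sub_eq_add_neg])
    (by rw [LinearMap.neg_comp, hσ, neg_neg]) h2
  rw [h]
  ext y
  simp only [LinearMap.mem_ker, LinearMap.sub_apply, LinearMap.neg_apply, LinearMap.add_apply,
    LinearMap.id_coe, id_eq]
  rw [show -σ y - y = -(σ y + y) by abel, neg_eq_zero]

end Summit.BirchSwinnertonDyer.BirchSwinnertonDyer.Cruxes.ResidualThetaCountLowerPureAtTwo.SideaK2G26
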